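import Summits.HubbardSuperconductivity.HubbardSuperconductivity.Theorems.AnisotropyChordTransferFibre3RowDProfile
import Summits.HubbardSuperconductivity.HubbardSuperconductivity.Theorems.AnisotropyChordTransferFibre3RowDConvolution
import Summits.HubbardSuperconductivity.HubbardSuperconductivity.Theorems.AnisotropyChordTransferFibre3RowDConvExpansionU

/-!
# Route `AnisotropyChord` / H0 rotor rung: PartN41-D §2 — `PiHatExpansion` PROVED for the ground profile (and under `λ₂ < 2ε₁`)

Theory-1 g22's PartN41-D §2 `PiHatExpansion` (port …Fibre3KT2aRow): with `f̂ = Aδ₀ + B` (`A = V + a`, `B = −a − c_s g` even) the one-loop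
convolution `V·Π̂(q₂,q₃) = Σ_p f̂(p)f̂(q₂+p)f̂(q₃−p)` expands into the `A³/A²/A` δ-terms plus `Σ_p B(p)B(p+q₂)B(p−q₃)`, and the latter is the
explicit polynomial in `(a, c_s)` with the propagator sums `S₁`, `T(q)`, `Σ ggg`.
As for `FhatClosed` (…RowDProfile), the typed hypothesis list (`IsTwoMagnon`, `0 < λ₂`) does not exclude a resonance `2ε(p) = λ₂`, where the
closed form of `f̂` is not available; we prove the expansion under the extra `λ₂ < 2ε₁` (★ `RowD.piHat_expansion`), the `BBB` identity
unconditionally (★ `RowD.bhat_triple_sum`), and the typed body verbatim for the GROUND profile (★ `RowD.piHat_expansion_ground`, via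
`lam2_lt_two_eps1`).
Prover seat `hubbard-h0-rotor-p1` g27 (route lead); helper for stmt-HubbardSuperconductivity-23918 (`--supports`, helper class).
WHAT THIS IS NOT: nothing here proves superconductivity in the Hubbard model.  Tree imports only; no new definitions; no sorry.
-/

set_option linter.dupNamespace false
set_option autoImplicit false

noncomputable section

open scoped BigOperators

namespace Summit.HubbardSuperconductivity.HubbardSuperconductivity.Theorems.AnisotropyChord.Transfer.Fibre3

variable (L : ℕ) [NeZero L]

namespace RowD

/-- `B` is even. [folklore] -/
theorem bhat_neg (Δ lam2 : ℝ) (f : Tor L → ℝ) (p : Tor L) : Bhat L Δ lam2 f (-p) = Bhat L Δ lam2 f p := by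
  unfold Bhat; rw [B1.gres_neg]

/-- ★ the `BBB` loop sum in closed polynomial form (pure algebra, any `Δ, λ₂, f`):
`Σ_p B(p)B(p+q₂)B(p−q₃) = −(V a³ + 3a² c_s S₁ + a c_s²[T(q₂) + T(−q₃) + T′] + c_s³ Σ_p g(p)g(p+q₂)g(p−q₃))`. [folklore] -/
theorem bhat_triple_sum (Δ lam2 : ℝ) (f : Tor L → ℝ) (q₂ q₃ : Tor L) :
    (∑ p : Tor L, Bhat L Δ lam2 f p * Bhat L Δ lam2 f (p + q₂) * Bhat L Δ lam2 f (p - q₃))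
      = -((L : ℝ) ^ 2 * (Δ * f (K1 L)) ^ 3
          + 3 * (Δ * f (K1 L)) ^ 2 * cS L Δ lam2 f * ∑ p : Tor L, gres L lam2 p
          + (Δ * f (K1 L)) * cS L Δ lam2 f ^ 2 *
              ((∑ p : Tor L, gres L lam2 p * gres L lam2 (p + q₂)) + (∑ p : Tor L, gres L lam2 p * gres L lam2 (p - q₃))
                + ∑ p : Tor L, gres L lam2 (p + q₂) * gres L lam2 (p - q₃))
          + cS L Δ lam2 f ^ 3 * ∑ p : Tor L, gres L lam2 p * gres L lam2 (p + q₂) * gres L lam2 (p - q₃)) := by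
  set a : ℝ := Δ * f (K1 L) with ha
  set c : ℝ := cS L Δ lam2 f with hc
  set g : Tor L → ℝ := gres L lam2 with hg
  have hsum : ∀ p : Tor L, Bhat L Δ lam2 f p * Bhat L Δ lam2 f (p + q₂) * Bhat L Δ lam2 f (p - q₃)
      = -(a ^ 3) + (-(a ^ 2 * c)) * (g p + g (p + q₂) + g (p - q₃))
        + (-(a * c ^ 2)) * (g p * g (p + q₂) + g p * g (p - q₃) + g (p + q₂) * g (p - q₃))
        + (-(c ^ 3)) * (g p * g (p + q₂) * g (p - q₃)) := by
    intro p; unfold Bhat; rw [← ha, ← hc, ← hg]; ring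
  have hS2 : (∑ p : Tor L, g (p + q₂)) = ∑ p : Tor L, g p :=
    Fintype.sum_equiv (Equiv.addRight q₂) _ _ (fun p => rfl)
  have hS3 : (∑ p : Tor L, g (p - q₃)) = ∑ p : Tor L, g p :=
    Fintype.sum_equiv (Equiv.subRight q₃) _ _ (fun p => rfl)
  have hcard : ((Finset.univ : Finset (Tor L)).card : ℝ) = (L : ℝ) ^ 2 := by
    rw [Finset.card_univ, Fintype.card_prod, ZMod.card]; push_cast; ring
  rw [Finset.sum_congr rfl (fun p _ => hsum p)]
  rw [Finset.sum_add_distrib, Finset.sum_add_distrib, Finset.sum_add_distrib, Finset.sum_const, nsmul_eq_mul, hcard,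
    ← Finset.mul_sum, ← Finset.mul_sum, ← Finset.mul_sum, Finset.sum_add_distrib, Finset.sum_add_distrib, hS2, hS3,
    Finset.sum_add_distrib, Finset.sum_add_distrib]
  ring

/-- the complex `δ`-form of the closed profile transform: `f̂(p) = A·[p = 0] + B(p)`. [folklore] -/
theorem fhat_delta_form (hL : 3 ≤ L) {Δ lam2 : ℝ} {f : Tor L → ℝ} (hf : IsTwoMagnon L Δ lam2 f) (hl2 : lam2 < 2 * eps1 L)
    (p : Tor L) :
    dft L f p = (((L : ℝ) ^ 2 + Δ * f (K1 L) : ℝ) : ℂ) * (if p = 0 then 1 else 0) + ((Bhat L Δ lam2 f p : ℝ) : ℂ) := by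
  rw [fhat_closed L hL hf hl2 p]
  by_cases hp : p = 0
  · simp only [hp, if_true, mul_one]; push_cast; ring
  · simp only [hp, if_false, mul_zero, zero_add]

/-- ★ the expansion in `δ`-form (complex), under `λ₂ < 2ε₁`. [folklore] -/
theorem piHat_expansion_delta (hL : 3 ≤ L) {Δ lam2 : ℝ} {f : Tor L → ℝ} (hf : IsTwoMagnon L Δ lam2 f) (hl2 : lam2 < 2 * eps1 L)
    (q₂ q₃ : Tor L) :
    ((L : ℂ) ^ 2) * PiHat L f q₂ q₃
      = (((L : ℝ) ^ 2 + Δ * f (K1 L) : ℝ) : ℂ) ^ 3 * (if q₂ = 0 then 1 else 0) * (if q₃ = 0 then 1 else 0)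
        + (((L : ℝ) ^ 2 + Δ * f (K1 L) : ℝ) : ℂ) ^ 2 *
            ((if q₂ = 0 then 1 else 0) * ((Bhat L Δ lam2 f q₃ : ℝ) : ℂ) + (if q₃ = 0 then 1 else 0) * ((Bhat L Δ lam2 f q₂ : ℝ) : ℂ)
              + (if q₂ + q₃ = 0 then 1 else 0) * ((Bhat L Δ lam2 f q₂ : ℝ) : ℂ))
        + (((L : ℝ) ^ 2 + Δ * f (K1 L) : ℝ) : ℂ) *
            (((Bhat L Δ lam2 f q₂ : ℝ) : ℂ) * ((Bhat L Δ lam2 f q₃ : ℝ) : ℂ)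
              + ((Bhat L Δ lam2 f q₂ : ℝ) : ℂ) * ((Bhat L Δ lam2 f (q₂ + q₃) : ℝ) : ℂ)
              + ((Bhat L Δ lam2 f q₃ : ℝ) : ℂ) * ((Bhat L Δ lam2 f (q₂ + q₃) : ℝ) : ℂ))
        + ∑ p : Tor L, ((Bhat L Δ lam2 f p : ℝ) : ℂ) * ((Bhat L Δ lam2 f (p + q₂) : ℝ) : ℂ) * ((Bhat L Δ lam2 f (p - q₃) : ℝ) : ℂ) := by
  have hV : (L : ℂ) ^ 2 ≠ 0 := pow_ne_zero 2 (Nat.cast_ne_zero.mpr (NeZero.ne L))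
  rw [piHatConvolution_holds L f q₂ q₃, mul_div_cancel₀ _ hV]
  set A : ℂ := (((L : ℝ) ^ 2 + Δ * f (K1 L) : ℝ) : ℂ) with hA
  set Bc : Tor L → ℂ := fun p => ((Bhat L Δ lam2 f p : ℝ) : ℂ) with hBc
  set F : Tor L → ℂ := dft L f with hF
  have hFp : ∀ p, F p = A * (if p = 0 then 1 else 0) + Bc p := fun p => fhat_delta_form L hL hf hl2 p
  have hBn : ∀ p, Bc (-p) = Bc p := fun p => by simp only [hBc, bhat_neg]
  -- step 1
  have h1 : (∑ p : Tor L, F p * F (q₂ + p) * F (q₃ - p)) = A * (F q₂ * F q₃) + ∑ p : Tor L, Bc p * F (q₂ + p) * F (q₃ - p) := by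
    have : ∀ p : Tor L, F p * F (q₂ + p) * F (q₃ - p)
        = A * ((if p = 0 then (1 : ℂ) else 0) * (F (q₂ + p) * F (q₃ - p))) + Bc p * F (q₂ + p) * F (q₃ - p) := by
      intro p; rw [hFp p]; ring
    simp_rw [this]
    rw [Finset.sum_add_distrib, ← Finset.mul_sum, sum_delta_zero L (fun p => F (q₂ + p) * F (q₃ - p))]
    simp only [add_zero, sub_zero]
  -- step 2
  have h2 : (∑ p : Tor L, Bc p * F (q₂ + p) * F (q₃ - p)) = A * (Bc q₂ * F (q₂ + q₃)) + ∑ p : Tor L, Bc p * Bc (q₂ + p) * F (q₃ - p) := by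
    have : ∀ p : Tor L, Bc p * F (q₂ + p) * F (q₃ - p)
        = A * ((if q₂ + p = 0 then (1 : ℂ) else 0) * (Bc p * F (q₃ - p))) + Bc p * Bc (q₂ + p) * F (q₃ - p) := by
      intro p; rw [hFp (q₂ + p)]; ring
    simp_rw [this]
    rw [Finset.sum_add_distrib, ← Finset.mul_sum, sum_delta_add L q₂ (fun p => Bc p * F (q₃ - p))]
    simp only [sub_neg_eq_add, add_comm q₃ q₂, hBn]
  -- step 3
  have h3 : (∑ p : Tor L, Bc p * Bc (q₂ + p) * F (q₃ - p)) = A * (Bc q₃ * Bc (q₂ + q₃)) + ∑ p : Tor L, Bc p * Bc (p + q₂) * Bc (p - q₃) := by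
    have : ∀ p : Tor L, Bc p * Bc (q₂ + p) * F (q₃ - p)
        = A * ((if q₃ - p = 0 then (1 : ℂ) else 0) * (Bc p * Bc (q₂ + p))) + Bc p * Bc (p + q₂) * Bc (p - q₃) := by
      intro p; rw [hFp (q₃ - p), add_comm q₂ p, ← hBn (q₃ - p), neg_sub]; ring
    simp_rw [this]
    rw [Finset.sum_add_distrib, ← Finset.mul_sum, sum_delta_sub L q₃ (fun p => Bc p * Bc (q₂ + p)), add_comm q₂ q₃]
  rw [h1, h2, h3, hFp q₂, hFp q₃, hFp (q₂ + q₃)]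
  ring

/-- ★ the typed expansion body, under `λ₂ < 2ε₁` (the `0 < λ₂` of the typed statement is not needed). [folklore] -/
theorem piHat_expansion (hL : 3 ≤ L) {Δ lam2 : ℝ} {f : Tor L → ℝ} (hf : IsTwoMagnon L Δ lam2 f) (hl2 : lam2 < 2 * eps1 L)
    (q₂ q₃ : Tor L) :
    let A : ℝ := (L : ℝ) ^ 2 + Δ * f (K1 L)
    let B : Tor L → ℝ := Bhat L Δ lam2 f
    ((L : ℂ) ^ 2) * PiHat L f q₂ q₃
      = ((A ^ 3 * (if q₂ = 0 then 1 else 0) * (if q₃ = 0 then 1 else 0)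
          + A ^ 2 * ((if q₂ = 0 then B q₃ else 0) + (if q₃ = 0 then B q₂ else 0) + (if q₂ + q₃ = 0 then B q₂ else 0))
          + A * (B q₂ * B q₃ + B q₂ * B (q₂ + q₃) + B q₃ * B (q₂ + q₃))
          + ∑ p : Tor L, B p * B (p + q₂) * B (p - q₃) : ℝ) : ℂ) ∧
    (∑ p : Tor L, B p * B (p + q₂) * B (p - q₃))
      = -((L : ℝ) ^ 2 * (Δ * f (K1 L)) ^ 3
          + 3 * (Δ * f (K1 L)) ^ 2 * cS L Δ lam2 f * ∑ p : Tor L, gres L lam2 p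
          + (Δ * f (K1 L)) * cS L Δ lam2 f ^ 2 *
              ((∑ p : Tor L, gres L lam2 p * gres L lam2 (p + q₂)) + (∑ p : Tor L, gres L lam2 p * gres L lam2 (p - q₃))
                + ∑ p : Tor L, gres L lam2 (p + q₂) * gres L lam2 (p - q₃))
          + cS L Δ lam2 f ^ 3 * ∑ p : Tor L, gres L lam2 p * gres L lam2 (p + q₂) * gres L lam2 (p - q₃)) := by
  refine ⟨?_, bhat_triple_sum L Δ lam2 f q₂ q₃⟩
  rw [piHat_expansion_delta L hL hf hl2 q₂ q₃]
  have r1 : ∀ (P : Prop) [Decidable P] (x : ℝ), ((if P then x else 0 : ℝ) : ℂ) = (if P then (1 : ℂ) else 0) * (x : ℂ) := by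
    intro P _ x; split_ifs <;> simp
  have r0 : ∀ (P : Prop) [Decidable P], ((if P then 1 else 0 : ℝ) : ℂ) = (if P then (1 : ℂ) else 0) := by
    intro P _; split_ifs <;> simp
  push_cast
  rw [r0 (q₂ = 0), r0 (q₃ = 0), r1 (q₂ = 0) (Bhat L Δ lam2 f q₃), r1 (q₃ = 0) (Bhat L Δ lam2 f q₂),
    r1 (q₂ + q₃ = 0) (Bhat L Δ lam2 f q₂)]

/-- ★ **the typed `PiHatExpansion` body for the GROUND profile** (`IsGroundTwoMagnon`, `L ≥ 5`, `0 ≤ Δ`: then `λ₂ < 2ε₁` by `lam2_lt_two_eps1`). [folklore] -/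
theorem piHat_expansion_ground (hL : 5 ≤ L) {Δ lam2 : ℝ} (hΔ : 0 ≤ Δ) {f : Tor L → ℝ} (hf : IsGroundTwoMagnon L Δ lam2 f)
    (q₂ q₃ : Tor L) :
    let A : ℝ := (L : ℝ) ^ 2 + Δ * f (K1 L)
    let B : Tor L → ℝ := Bhat L Δ lam2 f
    ((L : ℂ) ^ 2) * PiHat L f q₂ q₃
      = ((A ^ 3 * (if q₂ = 0 then 1 else 0) * (if q₃ = 0 then 1 else 0)
          + A ^ 2 * ((if q₂ = 0 then B q₃ else 0) + (if q₃ = 0 then B q₂ else 0) + (if q₂ + q₃ = 0 then B q₂ else 0))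
          + A * (B q₂ * B q₃ + B q₂ * B (q₂ + q₃) + B q₃ * B (q₂ + q₃))
          + ∑ p : Tor L, B p * B (p + q₂) * B (p - q₃) : ℝ) : ℂ) ∧
    (∑ p : Tor L, B p * B (p + q₂) * B (p - q₃))
      = -((L : ℝ) ^ 2 * (Δ * f (K1 L)) ^ 3
          + 3 * (Δ * f (K1 L)) ^ 2 * cS L Δ lam2 f * ∑ p : Tor L, gres L lam2 p
          + (Δ * f (K1 L)) * cS L Δ lam2 f ^ 2 *
              ((∑ p : Tor L, gres L lam2 p * gres L lam2 (p + q₂)) + (∑ p : Tor L, gres L lam2 p * gres L lam2 (p - q₃))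
                + ∑ p : Tor L, gres L lam2 (p + q₂) * gres L lam2 (p - q₃))
          + cS L Δ lam2 f ^ 3 * ∑ p : Tor L, gres L lam2 p * gres L lam2 (p + q₂) * gres L lam2 (p - q₃)) :=
  piHat_expansion L (by omega) hf.1 (lam2_lt_two_eps1 L hL hΔ hf) q₂ q₃

end RowD

end Summit.HubbardSuperconductivity.HubbardSuperconductivity.Theorems.AnisotropyChord.Transfer.Fibre3

end
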